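import Summits.NavierStokesRegularity.NavierStokesRegularity.Theorems.TerminalTraceTypeITraceScarL3NoConcentrationViscosity

set_option linter.dupNamespace false

/-!
# NO LOCAL ENERGY JUMP at a Type-I blow-up time (corollary of `tendsto_localEnergy_sub_top`)

For item `TerminalTrace.TypeITraceScarL3` (stmt-NavierStokesRegularity-18385): `(u,p)` classical on `[0,T)` with
viscosity `ν > 0`, Leray–Hopf on `[0,T]`, Type I in time at `T`.  Then on EVERY ball, at every centre
(backward-singular vertices included), the local `L²` norm and the local energy are CONTINUOUS FROM THE LEFT
at the blow-up time:

* `tendsto_eLpNorm_sub_top_ball` — `‖u(t) − u(T)‖_{L²(B(x₀,R))} → 0` (`eLpNorm` form of s33-3);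
* `tendsto_eLpNorm_ball_top` — `‖u(t)‖_{L²(B(x₀,R))} → ‖u(T)‖_{L²(B(x₀,R))}`;
* `tendsto_localEnergy_top` — `∫_{B(x₀,R)} |u(t)|² → ∫_{B(x₀,R)} |u(T)|²` as `t → T⁻`.

Known in substance in a stronger GLOBAL form (energy EQUALITY including the Type-I blow-up time):
Leslie–Shvydkoy, ARMA 230 (2018), Thm. 1.2 [cite: LeslieShvydkoy2017, Thm. 1.2]; the tree route is the local
CKN-slice proof of `…NoConcentration.lean`.  Reading for the crux portrait: the local energy at a LOUD survivor
`x₀` has the limit `∫_{B(x₀,r)}|u(T)|² ≤ |B₁|^{1/3} r ‖u(T)‖²_{L³(B(x₀,r))} = o(r)` — no energy is trapped at the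
scar — while the Barker–Prange `L³` floor (`typeI_singular_L3ParabolicFloor`) keeps `‖u(t)‖_{L³}` in the
similarity parabola above `γν`.  WHAT THIS IS NOT: not 18385, not a Type-I exclusion, NOT NS regularity.
-/

noncomputable section

open MeasureTheory Set Function Metric Filter Topology Literature.Analysis.FluidPDE
open scoped ENNReal NNReal

namespace Summit.NavierStokesRegularity.NavierStokesRegularity.Theorems.TypeITraceScarL3

/-- **`‖u(t) − u(T)‖_{L²(B(x₀,R))} → 0` as `t → T⁻`** at a Type-I blow-up time (the `eLpNorm` form of
`tendsto_localEnergy_sub_top`). [cite: LeslieShvydkoy2017, Thm. 1.2] -/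
theorem tendsto_eLpNorm_sub_top_ball {ν T : ℝ} (hν : 0 < ν) (hT : 0 < T)
    {u : ℝ → EuclideanSpace ℝ (Fin 3) → EuclideanSpace ℝ (Fin 3)}
    {p : ℝ → EuclideanSpace ℝ (Fin 3) → ℝ}
    (hcl : IsClassicalNSSolutionOn (Set.Ico 0 T) ν 0 u p) (hLH : IsLerayHopfOn T ν 0 (u 0) u)
    (hTI : IsTypeIBlowup u T) (x₀ : EuclideanSpace ℝ (Fin 3)) (R : ℝ) :
    Tendsto (fun t => eLpNorm (fun z => u t z - u T z) 2 (volume.restrict (ball x₀ R)))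
      (𝓝[<] T) (𝓝 0) := by
  have h := tendsto_localEnergy_sub_top hν hT hcl hLH hTI x₀ R
  have e : ∀ t, eLpNorm (fun z => u t z - u T z) 2 (volume.restrict (ball x₀ R)) =
      (∫⁻ z in ball x₀ R, ‖u t z - u T z‖ₑ ^ 2) ^ (1 / 2 : ℝ) := by
    intro t
    have hsq : eLpNorm (fun z => u t z - u T z) 2 (volume.restrict (ball x₀ R)) ^ 2 =
        ∫⁻ z in ball x₀ R, ‖u t z - u T z‖ₑ ^ 2 := by
      rw [eLpNorm_eq_lintegral_rpow_enorm_toReal two_ne_zero ENNReal.ofNat_ne_top,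
        ENNReal.toReal_ofNat, ENNReal.rpow_half_sq]
      simp_rw [ENNReal.rpow_two]
    rw [← hsq, ← ENNReal.rpow_natCast, ← ENNReal.rpow_mul]
    norm_num
  simp_rw [e]
  have h0 : ((0 : ℝ≥0∞)) = (0 : ℝ≥0∞) ^ (1 / 2 : ℝ) := by
    rw [ENNReal.zero_rpow_of_pos (by norm_num)]
  rw [h0]
  exact h.ennrpow_const (1 / 2)

/-- **The local `L²` norm is continuous from the left at a Type-I blow-up time**:
`‖u(t)‖_{L²(B(x₀,R))} → ‖u(T)‖_{L²(B(x₀,R))}` as `t → T⁻`, every centre and radius.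
[cite: LeslieShvydkoy2017, Thm. 1.2] -/
theorem tendsto_eLpNorm_ball_top {ν T : ℝ} (hν : 0 < ν) (hT : 0 < T)
    {u : ℝ → EuclideanSpace ℝ (Fin 3) → EuclideanSpace ℝ (Fin 3)}
    {p : ℝ → EuclideanSpace ℝ (Fin 3) → ℝ}
    (hcl : IsClassicalNSSolutionOn (Set.Ico 0 T) ν 0 u p) (hLH : IsLerayHopfOn T ν 0 (u 0) u)
    (hTI : IsTypeIBlowup u T) (x₀ : EuclideanSpace ℝ (Fin 3)) (R : ℝ) :
    Tendsto (fun t => eLpNorm (u t) 2 (volume.restrict (ball x₀ R)))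
      (𝓝[<] T) (𝓝 (eLpNorm (u T) 2 (volume.restrict (ball x₀ R)))) := by
  set μ : Measure (EuclideanSpace ℝ (Fin 3)) := volume.restrict (ball x₀ R) with hμ
  have hsub := tendsto_eLpNorm_sub_top_ball hν hT hcl hLH hTI x₀ R
  have huT : MemLp (u T) 2 volume := hLH.memLp T ⟨hT.le, le_rfl⟩
  have hTfin : eLpNorm (u T) 2 μ ≠ ⊤ := (huT.restrict (ball x₀ R)).eLpNorm_ne_top
  -- two-sided triangle inequalities, valid for `0 < t ≤ T`
  have hupper : ∀ t ∈ Ioo 0 T, eLpNorm (u t) 2 μ ≤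
      eLpNorm (u T) 2 μ + eLpNorm (fun z => u t z - u T z) 2 μ := by
    intro t ht
    have hut : MemLp (u t) 2 volume := hLH.memLp t ⟨ht.1.le, ht.2.le⟩
    have e : u t = fun z => u T z + (u t z - u T z) := by funext z; abel
    calc eLpNorm (u t) 2 μ = eLpNorm (fun z => u T z + (u t z - u T z)) 2 μ := by rw [← e]
      _ ≤ eLpNorm (u T) 2 μ + eLpNorm (fun z => u t z - u T z) 2 μ :=
          eLpNorm_add_le (huT.restrict _).aestronglyMeasurable
            ((hut.sub huT).restrict _).aestronglyMeasurable one_le_two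
  have hlower : ∀ t ∈ Ioo 0 T, eLpNorm (u T) 2 μ ≤
      eLpNorm (u t) 2 μ + eLpNorm (fun z => u t z - u T z) 2 μ := by
    intro t ht
    have hut : MemLp (u t) 2 volume := hLH.memLp t ⟨ht.1.le, ht.2.le⟩
    have e : u T = fun z => u t z - (u t z - u T z) := by funext z; abel
    calc eLpNorm (u T) 2 μ = eLpNorm (fun z => u t z - (u t z - u T z)) 2 μ := by rw [← e]
      _ ≤ eLpNorm (u t) 2 μ + eLpNorm (fun z => u t z - u T z) 2 μ :=
          eLpNorm_sub_le (hut.restrict _).aestronglyMeasurable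
            ((hut.sub huT).restrict _).aestronglyMeasurable one_le_two
  -- squeeze
  have hev : ∀ᶠ t in 𝓝[<] T, t ∈ Ioo 0 T := by
    rw [← nhdsWithin_Ioo_eq_nhdsLT hT]
    exact self_mem_nhdsWithin
  have hup : Tendsto (fun t => eLpNorm (u T) 2 μ + eLpNorm (fun z => u t z - u T z) 2 μ)
      (𝓝[<] T) (𝓝 (eLpNorm (u T) 2 μ)) := by
    have := (tendsto_const_nhds (x := eLpNorm (u T) 2 μ)).add hsub
    rwa [add_zero] at this
  have hlow : Tendsto (fun t => eLpNorm (u T) 2 μ - eLpNorm (fun z => u t z - u T z) 2 μ)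
      (𝓝[<] T) (𝓝 (eLpNorm (u T) 2 μ)) := by
    have := ENNReal.Tendsto.sub (tendsto_const_nhds (x := eLpNorm (u T) 2 μ)) hsub (Or.inl hTfin)
    rwa [tsub_zero] at this
  refine tendsto_of_tendsto_of_tendsto_of_le_of_le' hlow hup ?_ ?_
  · filter_upwards [hev] with t ht
    exact tsub_le_iff_right.2 (hlower t ht)
  · filter_upwards [hev] with t ht
    exact hupper t ht

/-- **NO LOCAL ENERGY JUMP at a Type-I blow-up time**: `∫_{B(x₀,R)} |u(t)|² → ∫_{B(x₀,R)} |u(T)|²` as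
`t → T⁻`, for every centre (backward-singular vertices included) and radius.  For the item's LOUD
survivor `x₀` the limit is `≤ |B₁|^{1/3} r ‖u(T)‖²_{L³(B(x₀,r))} = o(r)`: no energy is trapped at the scar.
[cite: LeslieShvydkoy2017, Thm. 1.2] -/
theorem tendsto_localEnergy_top {ν T : ℝ} (hν : 0 < ν) (hT : 0 < T)
    {u : ℝ → EuclideanSpace ℝ (Fin 3) → EuclideanSpace ℝ (Fin 3)}
    {p : ℝ → EuclideanSpace ℝ (Fin 3) → ℝ}
    (hcl : IsClassicalNSSolutionOn (Set.Ico 0 T) ν 0 u p) (hLH : IsLerayHopfOn T ν 0 (u 0) u)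
    (hTI : IsTypeIBlowup u T) (x₀ : EuclideanSpace ℝ (Fin 3)) (R : ℝ) :
    Tendsto (fun t => ∫⁻ z in ball x₀ R, ‖u t z‖ₑ ^ 2) (𝓝[<] T)
      (𝓝 (∫⁻ z in ball x₀ R, ‖u T z‖ₑ ^ 2)) := by
  have h := tendsto_eLpNorm_ball_top hν hT hcl hLH hTI x₀ R
  have e : ∀ v : EuclideanSpace ℝ (Fin 3) → EuclideanSpace ℝ (Fin 3),
      ∫⁻ z in ball x₀ R, ‖v z‖ₑ ^ 2 = eLpNorm v 2 (volume.restrict (ball x₀ R)) ^ 2 := by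
    intro v
    rw [eLpNorm_eq_lintegral_rpow_enorm_toReal two_ne_zero ENNReal.ofNat_ne_top,
      ENNReal.toReal_ofNat, ENNReal.rpow_half_sq]
    simp_rw [ENNReal.rpow_two]
  simp_rw [e]
  exact ((ENNReal.continuous_pow 2).tendsto _).comp h

end Summit.NavierStokesRegularity.NavierStokesRegularity.Theorems.TypeITraceScarL3

end
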